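import Literature.AnabelianGeometry.SemiGraphs.ProSigmaFreeFactorDisjoint
import HarnessLib

/-!
# Free-factor malnormality in pro-`Σ` completions, V: intersections of conjugates of two sub-basis closures

Companion to `ProSigmaFreeFactorMalnormal.lean` / `ProSigmaFreeFactorDisjoint.lean` (Ribes–Zalesskii,
*Profinite Groups*, Thm. 9.1.12 [cite: RibesZalesskii2010, Thm. 9.1.12], free pro-`Σ` groups).  Setting:
`Γ` free with basis `b : β → Γ`, `ι : Γ → P` a pro-`Σ` completion (`P` profinite), and for `S ⊆ β` the
closed subgroup `A_S := ((Subgroup.closure (b '' S)).map ι).topologicalClosure`.  The MIXED clause —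
how a conjugate of `A_T` meets `A_S` — which at a genuine multi-vertex pointed stable curve is the
statement "`Π_{v₁} ∩ gΠ_{v₂}g⁻¹` is trivial or a `Π_{v₁}`-conjugate of the nodal subgroup `Π_e`"
([CombGC] Prop. 1.2 / 1.5):

* `freeFactor_retract_mem_inter` — the retraction `ρ̂_T` maps `A_S` into `A_{S ∩ T}`;
* `freeFactor_inf_conj_eq_bot_of_not_mem_mul` — if `g ∉ A_S · A_T` then `A_S ∩ gA_Tg⁻¹ = 1`
  (for `1 ≠ y = gzg⁻¹` in the intersection, `y = ρ̂_S(g) ρ̂_S(z) ρ̂_S(g)⁻¹` and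
  `y = (gρ̂_T(g)⁻¹) ρ̂_T(y) (gρ̂_T(g)⁻¹)⁻¹` exhibit `y` in two conjugates of `A_{S∩T}`, whose malnormality
  forces `ρ̂_S(g)⁻¹ g ρ̂_T(g)⁻¹ ∈ A_{S∩T}`, i.e. `g ∈ A_S A_T`);
* `freeFactor_inf_conj_eq_smul_of_mem` — for `g = a t` (`a ∈ A_S`, `t ∈ A_T`):
  `A_S ∩ gA_Tg⁻¹ = a A_{S∩T} a⁻¹`;
* `freeFactor_inf_conj_eq_bot_or` — the dichotomy: `A_S ∩ gA_Tg⁻¹` is trivial or an `A_S`-conjugate of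
  `A_{S ∩ T}`.

Theorems only; classical profinite group theory; nothing here takes a side on [IUTchIII] Cor. 3.12.
-/

namespace Literature.AnabelianGeometry.SemiGraphs.SemiGraphOfAnabelioids.IsProSigmaCompletion

open Literature.AnabelianGeometry.Anabelioids Topology
open scoped Pointwise

variable {Sigma : Set ℕ} {Γ : Type*} [Group Γ] {P : Type*} [Group P] [TopologicalSpace P]
  [IsTopologicalGroup P] [CompactSpace P] [TotallyDisconnectedSpace P] {ι : Γ →* P}

omit [TopologicalSpace P] [IsTopologicalGroup P] [CompactSpace P] [TotallyDisconnectedSpace P] in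
/-- An element of `Y` conjugates `Y` to itself. [cite: RibesZalesskii2010, Thm. 9.1.12] -/
private theorem conj_smul_eq_self_of_mem₅ {Y : Subgroup P} {g : P} (hg : g ∈ Y) :
    ConjAct.toConjAct g • Y = Y := by
  ext z
  rw [Subgroup.mem_smul_pointwise_iff_exists]
  constructor
  · rintro ⟨s, hs, rfl⟩
    rw [ConjAct.toConjAct_smul]
    exact Y.mul_mem (Y.mul_mem hg hs) (Y.inv_mem hg)
  · intro hz
    refine ⟨g⁻¹ * z * g, Y.mul_mem (Y.mul_mem (Y.inv_mem hg) hz) hg, ?_⟩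
    rw [ConjAct.toConjAct_smul]
    group

omit [CompactSpace P] [TotallyDisconnectedSpace P] in
/-- **The retraction onto `A_T` maps `A_S` into `A_{S ∩ T}`** (`ρ_T` sends `b_s` to `b_s` if `s ∈ T` and
to `1` otherwise, so `ρ_T ⟨b(S)⟩ ≤ ⟨b(S ∩ T)⟩`; pass to closures by continuity).
[cite: RibesZalesskii2010, Thm. 9.1.12] -/
theorem freeFactor_retract_mem_inter [T2Space P] {β : Type*} (b : FreeGroupBasis β Γ) (S T : Set β)
    [DecidablePred (· ∈ T)] (ρ : Γ →* Γ) (hρ : ∀ j, ρ (b j) = if j ∈ T then b j else 1)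
    (ρh : P →* P) (hρhc : Continuous ρh) (hρhι : ∀ γ, ρh (ι γ) = ι (ρ γ)) {y : P}
    (hy : y ∈ ((Subgroup.closure (b '' S)).map ι).topologicalClosure) :
    ρh y ∈ ((Subgroup.closure (b '' (S ∩ T))).map ι).topologicalClosure := by
  have hρS : (Subgroup.closure (b '' S)).map ρ ≤ Subgroup.closure (b '' (S ∩ T)) := by
    rw [Subgroup.map_le_iff_le_comap, Subgroup.closure_le]
    rintro _ ⟨s, hs, rfl⟩
    rw [SetLike.mem_coe, Subgroup.mem_comap, hρ s]
    by_cases hsT : s ∈ T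
    · rw [if_pos hsT]; exact Subgroup.subset_closure ⟨s, ⟨hs, hsT⟩, rfl⟩
    · rw [if_neg hsT]; exact Subgroup.one_mem _
  have hle : ((Subgroup.closure (b '' S)).map ι).topologicalClosure ≤
      (((Subgroup.closure (b '' (S ∩ T))).map ι).topologicalClosure).comap ρh := by
    refine Subgroup.topologicalClosure_minimal _ ?_
      ((Subgroup.isClosed_topologicalClosure _).preimage hρhc)
    rintro _ ⟨d, hd, rfl⟩
    rw [Subgroup.mem_comap, hρhι]
    exact Subgroup.le_topologicalClosure _ ⟨ρ d, hρS ⟨d, hd, rfl⟩, rfl⟩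
  exact hle hy

/-- **The mixed clause, trivial case**: if `g ∉ A_S · A_T` then `A_S ∩ gA_Tg⁻¹ = 1`.  (Let
`y = gzg⁻¹ ≠ 1` lie in `A_S`, `z ∈ A_T`; with `a = ρ̂_S(g) ∈ A_S`, `t = ρ̂_T(g) ∈ A_T`:
`y = ρ̂_S(y) = a ρ̂_S(z) a⁻¹` and `z = ρ̂_T(z) = t⁻¹ ρ̂_T(y) t`, so `y` lies in `aA'a⁻¹ ∩ cA'c⁻¹` for
`A' = A_{S∩T}`, `c = gt⁻¹`; malnormality of `A'` gives `a⁻¹c ∈ A' ≤ A_S`, whence `g = ct ∈ A_S A_T`.)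
[cite: RibesZalesskii2010, Thm. 9.1.12] -/
theorem freeFactor_inf_conj_eq_bot_of_not_mem_mul [T2Space P] {β : Type*} (b : FreeGroupBasis β Γ)
    (S T : Set β) (hι : IsProSigmaCompletion Sigma ι) {g : P}
    (hg : g ∉ (((Subgroup.closure (b '' S)).map ι).topologicalClosure : Set P) *
      (((Subgroup.closure (b '' T)).map ι).topologicalClosure : Set P)) :
    ((Subgroup.closure (b '' S)).map ι).topologicalClosure ⊓
      ConjAct.toConjAct g • ((Subgroup.closure (b '' T)).map ι).topologicalClosure = ⊥ := by
  classical
  -- the two retractions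
  let ρS : Γ →* Γ := b.lift fun j => if j ∈ S then b j else 1
  have hρS : ∀ j, ρS (b j) = if j ∈ S then b j else 1 := fun j => b.lift_apply_basis _ j
  let ρT : Γ →* Γ := b.lift fun j => if j ∈ T then b j else 1
  have hρT : ∀ j, ρT (b j) = if j ∈ T then b j else 1 := fun j => b.lift_apply_basis _ j
  obtain ⟨fS, hfSc, hfSι'⟩ := exists_continuous_extend_profinite hι hι.index_open (ι.comp ρS)
  obtain ⟨fT, hfTc, hfTι'⟩ := exists_continuous_extend_profinite hι hι.index_open (ι.comp ρT)
  have hfSι : ∀ γ, fS (ι γ) = ι (ρS γ) := fun γ => hfSι' γ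
  have hfTι : ∀ γ, fT (ι γ) = ι (ρT γ) := fun γ => hfTι' γ
  obtain ⟨hfSA, hfSmem⟩ := freeFactor_retract_apply b S ρS hρS hι _ rfl fS hfSc hfSι
  obtain ⟨hfTA, hfTmem⟩ := freeFactor_retract_apply b T ρT hρT hι _ rfl fT hfTc hfTι
  -- notation-free abbreviations
  have hA'S : ((Subgroup.closure (b '' (S ∩ T))).map ι).topologicalClosure ≤
      ((Subgroup.closure (b '' S)).map ι).topologicalClosure :=
    Subgroup.topologicalClosure_mono (Subgroup.map_mono
      (Subgroup.closure_mono (Set.image_mono Set.inter_subset_left)))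
  rw [eq_bot_iff]
  rintro y ⟨hyS, hyT⟩
  obtain ⟨z, hz, rfl⟩ := (Subgroup.mem_smul_pointwise_iff_exists _ _ _).mp hyT
  rw [Subgroup.mem_bot]
  by_contra hy1
  apply hg
  -- `w' = ρ̂_S(z)`, `w = ρ̂_T(y)` lie in `A' = A_{S ∩ T}`
  have hw' : fS z ∈ ((Subgroup.closure (b '' (S ∩ T))).map ι).topologicalClosure := by
    rw [Set.inter_comm]
    exact freeFactor_retract_mem_inter b T S ρS hρS fS hfSc hfSι hz
  have hw : fT (ConjAct.toConjAct g • z) ∈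
      ((Subgroup.closure (b '' (S ∩ T))).map ι).topologicalClosure :=
    freeFactor_retract_mem_inter b S T ρT hρT fT hfTc hfTι hyS
  -- `y = a w' a⁻¹` with `a = ρ̂_S g`
  have e1 : ConjAct.toConjAct g • z = fS g * fS z * (fS g)⁻¹ := by
    conv_lhs => rw [← hfSA _ hyS]
    rw [ConjAct.toConjAct_smul, map_mul, map_mul, map_inv]
  -- `z = t⁻¹ w t` with `t = ρ̂_T g`, so `y = (g t⁻¹) w (g t⁻¹)⁻¹`
  have e2 : z = (fT g)⁻¹ * fT (ConjAct.toConjAct g • z) * fT g := by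
    conv_lhs => rw [← hfTA z hz, show z = g⁻¹ * (ConjAct.toConjAct g • z) * g by
      rw [ConjAct.toConjAct_smul]; group]
    rw [map_mul, map_mul, map_inv]
  have e3 : ConjAct.toConjAct g • z =
      (g * (fT g)⁻¹) * fT (ConjAct.toConjAct g • z) * (g * (fT g)⁻¹)⁻¹ := by
    conv_lhs => rw [ConjAct.toConjAct_smul, e2]
    group
  -- `u = a⁻¹ y a = w'` is a non-trivial element of `A' ∩ (a⁻¹c) A' (a⁻¹c)⁻¹`
  have hu1 : fS z ≠ 1 := by
    intro h
    apply hy1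
    rw [e1, h, mul_one, mul_inv_cancel]
  have hne : ((Subgroup.closure (b '' (S ∩ T))).map ι).topologicalClosure ⊓
      ConjAct.toConjAct ((fS g)⁻¹ * (g * (fT g)⁻¹)) •
        ((Subgroup.closure (b '' (S ∩ T))).map ι).topologicalClosure ≠ ⊥ := by
    intro hbot
    apply hu1
    have hmem : fS z ∈ ((Subgroup.closure (b '' (S ∩ T))).map ι).topologicalClosure ⊓
        ConjAct.toConjAct ((fS g)⁻¹ * (g * (fT g)⁻¹)) •
          ((Subgroup.closure (b '' (S ∩ T))).map ι).topologicalClosure := by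
      refine ⟨hw', (Subgroup.mem_smul_pointwise_iff_exists _ _ _).mpr ⟨_, hw, ?_⟩⟩
      rw [ConjAct.toConjAct_smul]
      have h13 := e1.symm.trans e3
      -- from `a w' a⁻¹ = c w c⁻¹` deduce `(a⁻¹c) w (a⁻¹c)⁻¹ = w'`
      calc (fS g)⁻¹ * (g * (fT g)⁻¹) * fT (ConjAct.toConjAct g • z) * ((fS g)⁻¹ * (g * (fT g)⁻¹))⁻¹
          = (fS g)⁻¹ * ((g * (fT g)⁻¹) * fT (ConjAct.toConjAct g • z) * (g * (fT g)⁻¹)⁻¹) * fS g := by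
            group
        _ = (fS g)⁻¹ * (fS g * fS z * (fS g)⁻¹) * fS g := by rw [← h13]
        _ = fS z := by group
    rw [hbot, Subgroup.mem_bot] at hmem
    exact hmem
  -- malnormality of `A'`: `a⁻¹ c ∈ A' ≤ A_S`, hence `c ∈ A_S` and `g = c t ∈ A_S A_T`
  have hmemA' := mem_freeFactor_of_inf_conj_ne_bot b (S ∩ T) hι hne
  have hc : g * (fT g)⁻¹ ∈ ((Subgroup.closure (b '' S)).map ι).topologicalClosure := by
    have := Subgroup.mul_mem _ (hfSmem g) (hA'S hmemA')
    rwa [mul_inv_cancel_left] at this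
  exact Set.mem_mul.mpr ⟨g * (fT g)⁻¹, hc, fT g, hfTmem g, by rw [inv_mul_cancel_right]⟩

/-- **The mixed clause, non-trivial case**: for `a ∈ A_S`, `t ∈ A_T`,
`A_S ∩ (at) A_T (at)⁻¹ = a A_{S ∩ T} a⁻¹`. [cite: RibesZalesskii2010, Thm. 9.1.12] -/
theorem freeFactor_inf_conj_eq_smul_of_mem [T2Space P] {β : Type*} (b : FreeGroupBasis β Γ)
    (S T : Set β) (hι : IsProSigmaCompletion Sigma ι) {a t : P}
    (ha : a ∈ ((Subgroup.closure (b '' S)).map ι).topologicalClosure)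
    (ht : t ∈ ((Subgroup.closure (b '' T)).map ι).topologicalClosure) :
    ((Subgroup.closure (b '' S)).map ι).topologicalClosure ⊓
      ConjAct.toConjAct (a * t) • ((Subgroup.closure (b '' T)).map ι).topologicalClosure =
        ConjAct.toConjAct a • ((Subgroup.closure (b '' (S ∩ T))).map ι).topologicalClosure := by
  rw [map_mul, mul_smul, conj_smul_eq_self_of_mem₅ ht, ← freeFactor_inf_eq b S T hι,
    Subgroup.smul_inf, conj_smul_eq_self_of_mem₅ ha]

/-- **The mixed clause (dichotomy)**: for every `g`, `A_S ∩ gA_Tg⁻¹` is either trivial or an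
`A_S`-conjugate `a A_{S ∩ T} a⁻¹` (`a ∈ A_S`) of the closure of the common sub-basis — at a genuine
two-component pointed stable curve: `Π_{v₁} ∩ gΠ_{v₂}g⁻¹` is `1` or a `Π_{v₁}`-conjugate of the nodal
subgroup `Π_e`. [cite: RibesZalesskii2010, Thm. 9.1.12] -/
theorem freeFactor_inf_conj_eq_bot_or [T2Space P] {β : Type*} (b : FreeGroupBasis β Γ) (S T : Set β)
    (hι : IsProSigmaCompletion Sigma ι) (g : P) :
    ((Subgroup.closure (b '' S)).map ι).topologicalClosure ⊓
        ConjAct.toConjAct g • ((Subgroup.closure (b '' T)).map ι).topologicalClosure = ⊥ ∨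
      ∃ a ∈ ((Subgroup.closure (b '' S)).map ι).topologicalClosure,
        ((Subgroup.closure (b '' S)).map ι).topologicalClosure ⊓
          ConjAct.toConjAct g • ((Subgroup.closure (b '' T)).map ι).topologicalClosure =
            ConjAct.toConjAct a • ((Subgroup.closure (b '' (S ∩ T))).map ι).topologicalClosure := by
  by_cases hg : g ∈ (((Subgroup.closure (b '' S)).map ι).topologicalClosure : Set P) *
      (((Subgroup.closure (b '' T)).map ι).topologicalClosure : Set P)
  · obtain ⟨a, ha, t, ht, rfl⟩ := Set.mem_mul.mp hg
    exact Or.inr ⟨a, ha, freeFactor_inf_conj_eq_smul_of_mem b S T hι ha ht⟩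
  · exact Or.inl (freeFactor_inf_conj_eq_bot_of_not_mem_mul b S T hι hg)

end Literature.AnabelianGeometry.SemiGraphs.SemiGraphOfAnabelioids.IsProSigmaCompletion
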